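import Summits.CriticalPhenomena.PercolationContinuityZ3.Theorems.PercNearOneGluingNoHeavyLowerTailTformLightStarInductionOpen
import HarnessLib

/-!
# `NoHeavyLowerTail` (stmt-CriticalPhenomena-4575) — corollaries of the open-recursion light-star induction

Support file (prover `prim-hp-5`, hull-port cell, T-form calculus, gen 3; `--supports stmt-CriticalPhenomena-4575`).
No definitions, no named facts, no sorries.  From `Theorems.xzDeficit_induction_open` with the trivial class:
* `attachedChampion_of_lightMultiStarPacking_open` — light multi-star packing, provable WITH ACCESS TO the deficit attached-champion
  inequality XZ⁺ of every graph with fewer positive pairs, implies the registered stub `stub_attachedChampion` verbatim;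
* `noHeavyLowerTail_of_lightMultiStarPacking_open` — and hence the crux.
This is the sharpest typed form of the residual left by this seat's line: to close `NoHeavyLowerTail` it suffices to prove the
packing inequality `μ_u(q ≁ B, 1 ≤ |π(B)| ≤ j) + μ_u(|π(B)| = 0, |π(c)| ≤ j) ≤ μ_u(q ≁ B, |π(q)| ≤ j)` (u = the graph with the
observer's pairs off, `q` its champion, `B` ≥ 2 non-relay gates of the observer all strictly lighter than `q`) — and in doing so one
may assume XZ⁺ for all strictly smaller instances.
-/

noncomputable section

namespace Summit.CriticalPhenomena.PercolationContinuityZ3.Theorems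

open MeasureTheory Set Literature.Probability.LatticeModels Literature.Probability.Percolation
open scoped Classical BigOperators

/-- **Light multi-star packing with access to XZ⁺ below ⇒ the attached-champion inequality** (registered stub
`stub_attachedChampion` verbatim). -/
theorem attachedChampion_of_lightMultiStarPacking_open
    (hLSP2 : ∀ (n : ℕ) (w : Sym2 (Fin n) → unitInterval) (A B : Finset (Fin n)) (o q c : Fin n) (j : ℕ),
      (∀ (n' : ℕ) (w' : Sym2 (Fin n') → unitInterval) (A' : Finset (Fin n')) (o' q' c' : Fin n') (j' : ℕ),
        (Finset.univ.filter fun e : Sym2 (Fin n') => w' e ≠ 0).card <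
          (Finset.univ.filter fun e : Sym2 (Fin n) => w e ≠ 0).card →
        o' ∉ A' → q' ∈ A' → c' ∈ A' →
        (∀ a ∈ A', (prodBernoulli w').real {ω : BondConfig (Fin n') | (A'.filter fun x => ω ∈ openConn a x).card ≤ j'} ≤
          (prodBernoulli w').real {ω : BondConfig (Fin n') | (A'.filter fun x => ω ∈ openConn q' x).card ≤ j'}) →
        (prodBernoulli w').real {ω : BondConfig (Fin n') |
            1 ≤ (A'.filter fun x => ω ∈ openConn o' x).card ∧ (A'.filter fun x => ω ∈ openConn o' x).card ≤ j'} +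
          (prodBernoulli w').real {ω : BondConfig (Fin n') | (A'.filter fun x => ω ∈ openConn c' x).card ≤ j'} ≤
        (prodBernoulli w').real {ω : BondConfig (Fin n') |
            (A'.filter fun x => ω ∈ openConn c' x).card ≤ j' ∧ 1 ≤ (A'.filter fun x => ω ∈ openConn o' x).card} +
          (prodBernoulli w').real {ω : BondConfig (Fin n') | (A'.filter fun x => ω ∈ openConn q' x).card ≤ j'}) →
      o ∉ A → q ∈ A → c ∈ A → 2 ≤ B.card → (∀ y ∈ B, y ∉ A ∧ y ≠ o ∧ w s(o, y) ≠ 0) →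
      (∀ a ∈ A, (prodBernoulli fun e => if e ∈ {e : Sym2 (Fin n) | o ∉ e} then w e else 0).real
          {ξ : BondConfig (Fin n) | (A.filter fun z => (openGraph ξ).Reachable a z).card ≤ j} ≤
        (prodBernoulli fun e => if e ∈ {e : Sym2 (Fin n) | o ∉ e} then w e else 0).real
          {ξ : BondConfig (Fin n) | (A.filter fun z => (openGraph ξ).Reachable q z).card ≤ j}) →
      (∀ y ∈ B, (prodBernoulli fun e => if e ∈ {e : Sym2 (Fin n) | o ∉ e} then w e else 0).real
          {ξ : BondConfig (Fin n) | (A.filter fun z => (openGraph ξ).Reachable q z).card ≤ j} <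
        (prodBernoulli fun e => if e ∈ {e : Sym2 (Fin n) | o ∉ e} then w e else 0).real
          {ξ : BondConfig (Fin n) | (A.filter fun z => (openGraph ξ).Reachable y z).card ≤ j}) →
      (prodBernoulli fun e => if e ∈ {e : Sym2 (Fin n) | o ∉ e} then w e else 0).real {ξ : BondConfig (Fin n) |
          (∀ y ∈ B, ¬ (openGraph ξ).Reachable q y) ∧
            1 ≤ (A.filter fun z => ∃ y ∈ B, (openGraph ξ).Reachable y z).card ∧
            (A.filter fun z => ∃ y ∈ B, (openGraph ξ).Reachable y z).card ≤ j} +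
        (prodBernoulli fun e => if e ∈ {e : Sym2 (Fin n) | o ∉ e} then w e else 0).real {ξ : BondConfig (Fin n) |
          ¬ 1 ≤ (A.filter fun z => ∃ y ∈ B, (openGraph ξ).Reachable y z).card ∧
            (A.filter fun z => (openGraph ξ).Reachable c z).card ≤ j} ≤
      (prodBernoulli fun e => if e ∈ {e : Sym2 (Fin n) | o ∉ e} then w e else 0).real {ξ : BondConfig (Fin n) |
          (∀ y ∈ B, ¬ (openGraph ξ).Reachable q y) ∧ (A.filter fun z => (openGraph ξ).Reachable q z).card ≤ j})
    (n : ℕ) (w : Sym2 (Fin n) → unitInterval) (A : Finset (Fin n)) (o q : Fin n) (j : ℕ) (ho : o ∉ A) (hq : q ∈ A)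
    (hchamp : ∀ a ∈ A,
      (prodBernoulli w).real {ω : BondConfig (Fin n) | (A.filter fun x => ω ∈ openConn a x).card ≤ j} ≤
        (prodBernoulli w).real {ω : BondConfig (Fin n) | (A.filter fun x => ω ∈ openConn q x).card ≤ j}) :
    (prodBernoulli w).real {ω : BondConfig (Fin n) |
        1 ≤ (A.filter fun x => ω ∈ openConn o x).card ∧ (A.filter fun x => ω ∈ openConn o x).card ≤ j} ≤
      (prodBernoulli w).real {ω : BondConfig (Fin n) |
        (A.filter fun x => ω ∈ openConn q x).card ≤ j ∧ 1 ≤ (A.filter fun x => ω ∈ openConn o x).card} := by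
  have h := xzDeficit_induction_open (fun _ _ _ => True) (fun _ _ _ _ _ => trivial)
    (fun n w A B o q c j _ ih ho hq hc hB hBy hch hl =>
      hLSP2 n w A B o q c j (fun n' w' A' o' q' c' j' hlt ho' hq' hc' hch' => ih n' w' A' o' q' c' j' hlt trivial ho' hq' hc' hch')
        ho hq hc hB hBy hch hl)
    ((Finset.univ.filter fun e : Sym2 (Fin n) => w e ≠ 0).card) n w A o q q j le_rfl trivial ho hq hq hchamp
  linarith

/-- **Light multi-star packing with access to XZ⁺ below closes the crux `NoHeavyLowerTail`.** -/
theorem noHeavyLowerTail_of_lightMultiStarPacking_open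
    (hLSP2 : ∀ (n : ℕ) (w : Sym2 (Fin n) → unitInterval) (A B : Finset (Fin n)) (o q c : Fin n) (j : ℕ),
      (∀ (n' : ℕ) (w' : Sym2 (Fin n') → unitInterval) (A' : Finset (Fin n')) (o' q' c' : Fin n') (j' : ℕ),
        (Finset.univ.filter fun e : Sym2 (Fin n') => w' e ≠ 0).card <
          (Finset.univ.filter fun e : Sym2 (Fin n) => w e ≠ 0).card →
        o' ∉ A' → q' ∈ A' → c' ∈ A' →
        (∀ a ∈ A', (prodBernoulli w').real {ω : BondConfig (Fin n') | (A'.filter fun x => ω ∈ openConn a x).card ≤ j'} ≤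
          (prodBernoulli w').real {ω : BondConfig (Fin n') | (A'.filter fun x => ω ∈ openConn q' x).card ≤ j'}) →
        (prodBernoulli w').real {ω : BondConfig (Fin n') |
            1 ≤ (A'.filter fun x => ω ∈ openConn o' x).card ∧ (A'.filter fun x => ω ∈ openConn o' x).card ≤ j'} +
          (prodBernoulli w').real {ω : BondConfig (Fin n') | (A'.filter fun x => ω ∈ openConn c' x).card ≤ j'} ≤
        (prodBernoulli w').real {ω : BondConfig (Fin n') |
            (A'.filter fun x => ω ∈ openConn c' x).card ≤ j' ∧ 1 ≤ (A'.filter fun x => ω ∈ openConn o' x).card} +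
          (prodBernoulli w').real {ω : BondConfig (Fin n') | (A'.filter fun x => ω ∈ openConn q' x).card ≤ j'}) →
      o ∉ A → q ∈ A → c ∈ A → 2 ≤ B.card → (∀ y ∈ B, y ∉ A ∧ y ≠ o ∧ w s(o, y) ≠ 0) →
      (∀ a ∈ A, (prodBernoulli fun e => if e ∈ {e : Sym2 (Fin n) | o ∉ e} then w e else 0).real
          {ξ : BondConfig (Fin n) | (A.filter fun z => (openGraph ξ).Reachable a z).card ≤ j} ≤
        (prodBernoulli fun e => if e ∈ {e : Sym2 (Fin n) | o ∉ e} then w e else 0).real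
          {ξ : BondConfig (Fin n) | (A.filter fun z => (openGraph ξ).Reachable q z).card ≤ j}) →
      (∀ y ∈ B, (prodBernoulli fun e => if e ∈ {e : Sym2 (Fin n) | o ∉ e} then w e else 0).real
          {ξ : BondConfig (Fin n) | (A.filter fun z => (openGraph ξ).Reachable q z).card ≤ j} <
        (prodBernoulli fun e => if e ∈ {e : Sym2 (Fin n) | o ∉ e} then w e else 0).real
          {ξ : BondConfig (Fin n) | (A.filter fun z => (openGraph ξ).Reachable y z).card ≤ j}) →
      (prodBernoulli fun e => if e ∈ {e : Sym2 (Fin n) | o ∉ e} then w e else 0).real {ξ : BondConfig (Fin n) |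
          (∀ y ∈ B, ¬ (openGraph ξ).Reachable q y) ∧
            1 ≤ (A.filter fun z => ∃ y ∈ B, (openGraph ξ).Reachable y z).card ∧
            (A.filter fun z => ∃ y ∈ B, (openGraph ξ).Reachable y z).card ≤ j} +
        (prodBernoulli fun e => if e ∈ {e : Sym2 (Fin n) | o ∉ e} then w e else 0).real {ξ : BondConfig (Fin n) |
          ¬ 1 ≤ (A.filter fun z => ∃ y ∈ B, (openGraph ξ).Reachable y z).card ∧
            (A.filter fun z => (openGraph ξ).Reachable c z).card ≤ j} ≤
      (prodBernoulli fun e => if e ∈ {e : Sym2 (Fin n) | o ∉ e} then w e else 0).real {ξ : BondConfig (Fin n) |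
          (∀ y ∈ B, ¬ (openGraph ξ).Reachable q y) ∧ (A.filter fun z => (openGraph ξ).Reachable q z).card ≤ j}) :
    Summit.CriticalPhenomena.PercolationContinuityZ3.Theses.PercNearOneGluing.NoHeavyLowerTail :=
  noHeavyLowerTail_of_attachedChampion fun n w A o q j ho hq hchamp =>
    attachedChampion_of_lightMultiStarPacking_open hLSP2 n w A o q j ho hq hchamp

end Summit.CriticalPhenomena.PercolationContinuityZ3.Theorems

end
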